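import Summits.CriticalPhenomena.PercolationContinuityZ3.Theorems.Transplant.SkelPhiCellsConcG
import Summits.CriticalPhenomena.PercolationContinuityZ3.Theorems.Transplant.PlanarCells2FaceRows
import Summits.CriticalPhenomena.PercolationContinuityZ3.Theorems.Transplant.SkelConcFaceRegion
import HarnessLib

/-!
# D″ node, (F) part 1 at φ-level (DPRIME-SCOPE §2 L6′, hp-8 column): the REGION of the face step `cond_j` over the two-unit cell geometry of
# record `Skelφ.cellGeomSG G φ P w₀ Λ` (p2-g7, p248544) — the plain window `Skelφ.Win G φ w₀ (P.farAS x du j) (rE_{a'}(x,du))` over the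
# shrunk far rows and why it lies in the span `E^far_{a'}(x,du)` — φ-level re-cut of `SkelConcFaceRegion` §2 (hp-8 g24, p234591) with
# `PCells ↦ PCells2` (two units: run-axis unit `r∥ = P.r du.1`, transverse unit `r⊥ = P.r (oth du.1)`); its §1 (planar) is already in the
# tree as `PlanarCells2Defs/Contain/Levels/FaceRows` (`PCells2.farAS`, `faceLo/faceHi`, `faceRow_enlarge_subset_farAS`, …), and the Φ-free
# geodesic-predecessor lemma `PlanarSkeletonConc.exists_adj_mem_graphBall_of_ne` is IMPORTED

builds on p205010 (kernel theorem, internal audit signed; external expert review pending) — nothing in this file uses p205010.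
Lane `prim-bschramm`, seat `prim-hp-8` (gen 30; L6′ (F) owner); helper file (`--supports stmt-CriticalPhenomena-4575`).  Hypotheses through
p3-g7's dictionary (DPRIME-SCOPE addendum K): `hlip : Skelφ.Lip G φ` (geodesic predecessor footprints, ℓ^∞-gap separation) and
`hstep : Skelφ.Steps G φ` (the root's step neighbour); the cell parameter `P : PCells2` and the schedule `Λ : ConcRadiiG` are explicit
arguments (never structure fields); `hΛ : Skelφ.WF2 P Λ` / `Skelφ.WFS2 P Λ` where a radius order is used.  The depth-rim design D1 of
FROM-prim-hp-8-g26-F-CHAIN-MAP §2 is untouched: window depth `rE_{a'}(x,du)` exactly, planar region `farAS` one unit inside `farAN`.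
* §1 **`Win_subset_VWin_of_thicken (hlip) (hstep)`** (a plain window lies in the span of the window over a planar 1-thickening, depth `≥ 1`),
  `sep_Q_farAS (hlip)`;
* §2 over `cellGeomSG`: **`Win_farAS_subset_Efar`** (`1 ≤ rE`), `M_subset_Win_farAS` (true target inside the region, `j ≤ K`, `WF2.ME`),
  `Face_subset_Win_faceRow` (`F^{j+1} ⊆ X_0`, `WF2.ρE`), `sep_Q_Win_farAS (hlip)` (no `G`-edge from the cube span into the region),
  `disjoint_Win_farAS_Stub`, `disjoint_Win_farAS_Ewv`.
Call sites port from `Skel.*`/`PlanarSkeletonConc.*` by `Φ ↦ hlip hstep` resp. nothing, `C ↦ P` (K2.2).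
[cite: KozmaNitzan2024, §4 p. 26 (E_{v,x}, M_x), p. 27 ((30)), p. 30 (Step III: F^{j+1} and the levels above it), p. 31 (D is a subbox of Ω)]
-/

noncomputable section

open scoped Classical

namespace Summit.CriticalPhenomena.PercolationContinuityZ3.Theorems.Transplant

namespace Skelφ

open Literature.Probability.Percolation Literature.Probability.LatticeModels SimpleGraph KNCells Contour
open Literature.Probability.Percolation.KozmaNitzan
open Literature.Probability.Percolation.KozmaNitzan.Cells (oth oth_ne sgOf sgOf_sign stepVec_apply_fst stepVec_apply_oth eq_oth_of_ne oth_oth)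
open Literature.Barriers.CriticalPhenomena (graphBall graphBall_finite mem_graphBall_self graphBall_mono)
open BoxProdZ2 (ConcRadiiG)

variable {V : Type} [DecidableEq V] {G : SimpleGraph V} [G.LocallyFinite] {φ : V → Site 2}

/-! ## §1 Windows over planar 1-thickenings; the cube / far-row separation -/

/-- **A plain window lies in the span of a window over a planar 1-thickening** (depth `≥ 1`; from `Lip` and `Steps`): every vertex of
`Win w₀ Pl R` other than the root has its geodesic predecessor inside `Win w₀ Pl' R` (`Lip`), the root has its `Steps`-neighbour there
(φ-level form of `PlanarSkeletonConc.Win_subset_VWin_of_thicken`). [this work] -/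
theorem Win_subset_VWin_of_thicken (hlip : Lip G φ) (hstep : Steps G φ) {w₀ : V} {Pl Pl' : Finset (Site 2)}
    (hP : ∀ t ∈ Pl, ∀ t' : Site 2, (∀ i, |t' i - t i| ≤ 1) → t' ∈ Pl') {R : ℕ} (hR : 1 ≤ R) :
    Win G φ w₀ Pl R ⊆ VWin G φ w₀ Pl' R := by
  intro y hy
  obtain ⟨hyB, hyP⟩ := (mem_Win G φ).1 hy
  have hyP' : φ y ∈ Pl' := hP _ hyP _ fun i => by simp
  by_cases hne : y = w₀
  · subst hne
    refine mem_VWin_of_step hstep (mem_graphBall_self G y 0) (by omega) hyP' (i := 0) (σ := 1) (hP _ hyP _ fun i => ?_)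
    by_cases hi : i = 0
    · subst hi; simp
    · simp [hi]
  · obtain ⟨z, hz, hadj⟩ := PlanarSkeletonConc.exists_adj_mem_graphBall_of_ne hyB hne
    have hzP' : φ z ∈ Pl' := hP _ hyP _ fun i => by rw [abs_sub_comm]; exact hlip hadj.symm i
    exact (PlanarSkeletonConc.mem_vspan_edgesIn_of_adj ((mem_Win G φ).2 ⟨hyB, hyP'⟩) ((mem_Win G φ).2 ⟨hz, hzP'⟩) hadj.symm).1

omit [DecidableEq V] [G.LocallyFinite] in
/-- No `G`-edge joins a vertex over the cube `Q_x` to a vertex over `farAS x du j` (planar ℓ^∞ gap `2`, `Lip`; two-unit cells).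
[cite: KozmaNitzan2024, §4 p. 26 ((29))] -/
theorem sep_Q_farAS (hlip : Lip G φ) (P : PCells2) (x : Site 2) (du : MDir) (j : ℕ) {X Y : Finset V} (hX : ∀ a ∈ X, φ a ∈ P.Q x)
    (hY : ∀ b ∈ Y, φ b ∈ P.farAS x du j) : KNCells.Sep G X Y :=
  sep_of_sepInf hlip (P.Q_sepInf_farAS x du j) hX hY

/-! ## §2 Windows over the shrunk far rows lie in the span `E^far` (cell geometry of record, two units) -/

variable (P : PCells2) (w₀ : V) {Λ : ConcRadiiG}

/-- **The face-step window lies in the far region of record**: `Win w₀ (farAS x du j) (rE_{a'}(x,du)) ⊆ E^far_{a'}(x, du)` (a span), as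
soon as `1 ≤ rE_{a'}(x, du)` (under `WFS2`: `le_trans (by omega) (hΛ.ρE1 a' x du 0)` — not a named lemma, it would print like `Skel.WFS.one_le_rE`) (φ-level form of `Skel.Win_farAS_subset_Efar`).
[cite: KozmaNitzan2024, §4 p. 31 (D ⊆ Ω)] -/
theorem Win_farAS_subset_Efar (hlip : Lip G φ) (hstep : Steps G φ) {a' : ℕ} {x : Site 2} {du : MDir} (hE : 1 ≤ Λ.rE a' x du) (j : ℕ) :
    Win G φ w₀ (P.farAS x du j) (Λ.rE a' x du) ⊆ (cellGeomSG G φ P w₀ Λ).Efar a' x du :=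
  Win_subset_VWin_of_thicken hlip hstep (fun _ ht _ h => P.mem_EfarN_of_near_farAS ht h) hE

/-- **The true target lies in the face-step window**: `M_{a'}(x + du) ⊆ Win w₀ (farAS x du j) (rE_{a'}(x,du))` (`j ≤ K`, `rM ≤ rE`)
(φ-level form of `Skel.M_subset_Win_farAS`). [cite: KozmaNitzan2024, §4 p. 26 (M_x ⊆ E_{v,x})] -/
theorem M_subset_Win_farAS (hW : WF2 P Λ) {a' : ℕ} (x : Site 2) (du : MDir) {j : ℕ} (hj : j ≤ P.K) :
    (cellGeomSG G φ P w₀ Λ).M a' (x + stepVec du) ⊆ Win G φ w₀ (P.farAS x du j) (Λ.rE a' x du) := by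
  change VWin G φ w₀ (P.M (x + stepVec du)) (Λ.rM a' (x + stepVec du)) ⊆ _
  exact (VWin_subset_Win w₀ _ _).trans (Win_mono G φ (P.M_add_stepVec_subset_farAS x du hj) (hW.ME a' x du))

/-- **The face `F^{j+1}` lies in the zeroth level window over the shifted face row**: `Face_{a'}(x, du, j+1) ⊆ Win w₀ [faceLo, faceHi] rE`
(φ-level form of `Skel.Face_subset_Win_faceRow`). [cite: KozmaNitzan2024, §4 p. 30 (Step III: the source box F^{j+1})] -/
theorem Face_subset_Win_faceRow (hW : WF2 P Λ) (a' : ℕ) (x : Site 2) (du : MDir) (j : ℕ) :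
    (faceDataSG G φ P w₀ Λ).Face a' x du (j + 1) ⊆ Win G φ w₀ (Finset.Icc (P.faceLo x du j) (P.faceHi x du j)) (Λ.rE a' x du) := by
  intro y hy
  change y ∈ (VStair G φ w₀ (P.Stub x du (j + 1)) (prof P Λ a' x du)).filter
    (fun y => P.lev du x (φ y) = 5 * (P.r du.1 : ℤ) + 10 * (P.s du.1 : ℤ) * (j + 1 : ℕ) - 1) at hy
  obtain ⟨hy, hl⟩ := Finset.mem_filter.1 hy
  obtain ⟨hP, hd⟩ := mem_of_mem_VStair hy
  exact (mem_Win G φ).2 ⟨graphBall_mono G w₀ (hW.ρE a' x du _) hd, P.mem_faceRow_of_mem_Stub hP hl⟩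

omit [DecidableEq V] in
/-- **No `G`-edge from the cube span `Q_a(x)` into the face-step window** (from `Lip`) (φ-level form of `Skel.sep_Q_Win_farAS`).
[cite: KozmaNitzan2024, §4 p. 26 ((29))] -/
theorem sep_Q_Win_farAS [DecidableEq V] (hlip : Lip G φ) (a : ℕ) (x : Site 2) (du : MDir) (j R : ℕ) :
    KNCells.Sep G ((cellGeomSG G φ P w₀ Λ).Q a x) (Win G φ w₀ (P.farAS x du j) R) :=
  sep_Q_farAS hlip P x du j (fun _ ha => φ_mem_of_mem_VWin ha) (fun _ hb => ((mem_Win G φ).1 hb).2)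

/-- The face-step window misses the stub span `Stub_{a'}(x, du, j)` (planar footprints: `farAN ∩ Stub = ∅`) (φ-level form of
`Skel.disjoint_Win_farAS_Stub`). [folklore] -/
theorem disjoint_Win_farAS_Stub (a' : ℕ) (x : Site 2) (du : MDir) (j R : ℕ) :
    Disjoint (Win G φ w₀ (P.farAS x du j) R) ((cellGeomSG G φ P w₀ Λ).Stub a' x du j) := by
  change Disjoint _ (VStair G φ w₀ (P.Stub x du j) (prof P Λ a' x du))
  exact Finset.disjoint_left.2 fun y ha hb => Finset.disjoint_left.1 (P.farAN_disjoint_Stub x du j)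
    (P.farAS_subset_farAN x du j ((mem_Win G φ).1 ha).2) (mem_of_mem_VStair hb).1

/-- The face-step window misses `E_{w,v}` of the incoming edge (planar footprints: `EwvN ∩ EfarN = ∅` for `du ≠ rev δw`) (φ-level form of
`Skel.disjoint_Win_farAS_Ewv`). [folklore] -/
theorem disjoint_Win_farAS_Ewv (a : ℕ) (w : Site 2) {δw du : MDir} (hne : du ≠ rev δw) (j R : ℕ) :
    Disjoint (Win G φ w₀ (P.farAS (w + stepVec δw) du j) R) ((cellGeomSG G φ P w₀ Λ).Ewv a w δw) := by
  have h := P.EwvN_disjoint_EfarN w hne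
  rw [PCells2.EwvN, Finset.disjoint_union_left] at h
  change Disjoint _ (VWin G φ w₀ (P.BtwN w δw) (Λ.rB a w δw) ∪ VWin G φ w₀ (P.Q (w + stepVec δw)) (Λ.rQ a (w + stepVec δw)))
  rw [Finset.disjoint_union_right]
  refine ⟨Finset.disjoint_left.2 fun y ha hb => Finset.disjoint_left.1 h.1.symm
      (P.farAS_subset_EfarN _ du j ((mem_Win G φ).1 ha).2) (φ_mem_of_mem_VWin hb),
    Finset.disjoint_left.2 fun y ha hb => Finset.disjoint_left.1 h.2.symm
      (P.farAS_subset_EfarN _ du j ((mem_Win G φ).1 ha).2) (φ_mem_of_mem_VWin hb)⟩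

end Skelφ

end Summit.CriticalPhenomena.PercolationContinuityZ3.Theorems.Transplant

end
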